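import Mathlib
import Literature.MathematicalPhysics.QuantumLattice.HubbardBandSectorCountingCounts
import HarnessLib

/-!
# Four-sector counting on the band Fermi curve: the fold-in-`t` count (lemma L5) at a `t`-AFFINE tolerance `δ₀ + δ₁·t`

Topic `Literature/MathematicalPhysics/QuantumLattice`; sub-namespace `BandSectorCounting` (continues `HubbardBandSectorCountingToolbox/Counts`).
Part (F2) of the log-free ANISOTROPIC anchored four-sector counting lemma («E1-P2-THIN-COUNT», cell gate-hubbard-kl, plan g17 (R41); seat p4; plan
HOME/prover-p4/E1-P2-THIN-COUNT-PLAN.md §Refinement 3).  The thin fold tolerance (`ThinSectorCount.abs_level3_le_thin_fold`) along an anti-diagonal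
`(σ − t/2, σ + t/2)` is `δ_σ + δ₁·t` with a per-`σ` constant `δ_σ` and `δ₁ ≍ w`.  The Toolbox's fold count (`pair_close_L5` / `gridCount_L5`, BGM 2006
App. A2, the even shift) takes a CONSTANT tolerance; bounding `δ₁t ≤ δ₁τ` would be the fat isotropic tolerance again.  This file re-runs L5 with the affine
tolerance: in the cluster inequality `(c/2)(t₂² − t₁²) ≤ |F t₂ − F t₁| ≤ 2δ₀ + δ₁(t₁ + t₂)` the affine part cancels against `t₁ + t₂`, so each cluster
widens by the CONSTANT `2δ₁/c` only — `O(1)` cells per anti-diagonal, `O(N)` in total, no logarithm: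

* **`pair_close_L5_affine`** — two points of `{|F t| ≤ δ₀ + δ₁t, |G t| ≤ 2λ}` within `min(η₀/(2Mτ), 2λ/M_G)` are within
  `2√(δ₀/c) + 2δ₁/c`, and within `2δ₀√(2M)/(c√|F 0|) + 2δ₁/c` when `|F 0| > 2(δ₀ + δ₁τ)`;
* **`gridCount_L5_affine`** — the grid count `#{i < K₀ : …} ≤ (K₀w/ℓ + 1)·2(L/w + 1)` with that `L`;
* **`count_anti_sigma_affine`** — the instance on the band curve (`F(t) = h(θ₁; σ − t/2, σ + t/2)`, key bound `even_key`), the affine twin of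
  `count_anti_sigma`.

Everything is PROVED; no definitions, no named facts.

## Sources

* G. Benfatto, A. Giuliani, V. Mastropietro, Ann. Henri Poincaré 7 (2006) 809–898, Lemma 3.1, App. A2 (even shift). [BenfattoGiulianiMastropietro2006]
* V. Mastropietro, *Non-Perturbative Renormalization* (World Scientific, 2008), ch. 14, (14.67) p. 223; p. 229. [Mastropietro2008]
-/

noncomputable section

open Real Set
open Literature.MathematicalPhysics.QuantumLattice

namespace Literature.MathematicalPhysics.QuantumLattice.BandSectorCounting

/-! ## §1 The generic affine-tolerance fold lemma -/

/-- **(L5, affine tolerance)** With `|F′(t)| ≤ M t`, `G` `M_G`-Lipschitz and the key lower bound `c t ≤ |F′ t|` on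
`{0 < t ≤ τ, |F| ≤ η₀, |G| ≤ 4λ}`, two points `0 < t₁ ≤ t₂ ≤ τ` of `{|F t| ≤ δ₀ + δ₁t, |G t| ≤ 2λ}` (`δ₀ + δ₁τ ≤ η₀/2`) within `min(η₀/(2Mτ), 2λ/M_G)` are
within `2√(δ₀/c) + 2δ₁/c`, and within `2δ₀√(2M)/(c√|F 0|) + 2δ₁/c` when `|F 0| > 2(δ₀ + δ₁τ)`.
[cite: BenfattoGiulianiMastropietro2006, Lemma 3.1 / App. A2] -/
theorem pair_close_L5_affine {F F' G : ℝ → ℝ} (hF : ∀ t, HasDerivAt F (F' t) t)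
    {M MG c lam η₀ τ δ₀ δ₁ : ℝ} (hM : 0 < M) (hMG : 0 < MG) (hc : 0 < c) (hlam : 0 < lam)
    (hτ : 0 < τ) (hδ₀ : 0 ≤ δ₀) (hδ₁ : 0 ≤ δ₁) (hδη : δ₀ + δ₁ * τ ≤ η₀ / 2)
    (hF'bd : ∀ t, |F' t| ≤ M * |t|) (hG : ∀ t t', |G t - G t'| ≤ MG * |t - t'|)
    (hkey : ∀ t, 0 < t → t ≤ τ → |F t| ≤ η₀ → |G t| ≤ 4 * lam → c * t ≤ |F' t|)
    {t₁ t₂ : ℝ} (h0 : 0 < t₁) (h12 : t₁ ≤ t₂) (h2τ : t₂ ≤ τ)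
    (h1 : |F t₁| ≤ δ₀ + δ₁ * t₁ ∧ |G t₁| ≤ 2 * lam) (h2 : |F t₂| ≤ δ₀ + δ₁ * t₂ ∧ |G t₂| ≤ 2 * lam)
    (hclose : t₂ - t₁ ≤ min (η₀ / (2 * M * τ)) (2 * lam / MG)) :
    t₂ - t₁ ≤ (if |F 0| ≤ 2 * (δ₀ + δ₁ * τ) then 2 * Real.sqrt (δ₀ / c) + 2 * δ₁ / c
      else 2 * δ₀ * Real.sqrt (2 * M) / (c * Real.sqrt |F 0|) + 2 * δ₁ / c) := by
  have hc1 : t₂ - t₁ ≤ η₀ / (2 * M * τ) := hclose.trans (min_le_left _ _)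
  have hc2 : t₂ - t₁ ≤ 2 * lam / MG := hclose.trans (min_le_right _ _)
  have h1τ : t₁ ≤ τ := h12.trans h2τ
  have hF1 : |F t₁| ≤ δ₀ + δ₁ * τ := h1.1.trans (by nlinarith)
  have hF2 : |F t₂| ≤ δ₀ + δ₁ * t₂ := h2.1
  -- on `[t₁, t₂]` the key bound applies
  have hin : ∀ z ∈ Icc t₁ t₂, c * z ≤ |F' z| := by
    intro z hz
    have hz0 : 0 < z := h0.trans_le hz.1
    have hzτ : z ≤ τ := hz.2.trans h2τ
    refine hkey z hz0 hzτ ?_ ?_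
    · have hbd : ∀ s ∈ Icc t₁ t₂, |F' s| ≤ M * τ := fun s hs =>
        (hF'bd s).trans (by rw [abs_of_pos (h0.trans_le hs.1)]; exact mul_le_mul_of_nonneg_left (hs.2.trans h2τ) hM.le)
      have h1' := abs_sub_le_of_abs_deriv_le hF hbd hz
      have h2' : M * τ * (z - t₁) ≤ η₀ / 2 := by
        calc M * τ * (z - t₁) ≤ M * τ * (η₀ / (2 * M * τ)) :=
              mul_le_mul_of_nonneg_left (by linarith [hz.2]) (by positivity)
          _ = η₀ / 2 := by field_simp
      have := abs_sub_abs_le_abs_sub (F z) (F t₁)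
      linarith
    · have h1' := hG z t₁
      rw [abs_of_nonneg (sub_nonneg.2 hz.1)] at h1'
      have h2' : MG * (z - t₁) ≤ 2 * lam := by
        calc MG * (z - t₁) ≤ MG * (2 * lam / MG) := mul_le_mul_of_nonneg_left (by linarith [hz.2]) hMG.le
          _ = 2 * lam := by field_simp
      have := abs_sub_abs_le_abs_sub (G z) (G t₁)
      linarith [h1.2]
  -- hence `F'` has a sign on `[t₁, t₂]` and `|F t₂ - F t₁| ≥ (c/2)(t₂² - t₁²)`
  have hne : ∀ z ∈ Icc t₁ t₂, F' z ≠ 0 := fun z hz h0' => by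
    have := hin z hz; rw [h0', abs_zero] at this
    have : 0 < c * z := mul_pos hc (h0.trans_le hz.1)
    linarith
  have hD : c / 2 * (t₂ ^ 2 - t₁ ^ 2) ≤ |F t₂ - F t₁| := by
    rcases hasDerivWithinAt_forall_lt_or_forall_gt_of_forall_ne (convex_Icc t₁ t₂)
      (fun z _ => (hF z).hasDerivWithinAt) hne with hneg | hpos
    · have hφ' : ∀ t, HasDerivAt (fun t => -F t - c / 2 * (t * t)) (-F' t - c * t) t := by
        intro t
        have := ((hF t).fun_neg).fun_sub (((hasDerivAt_id' t).fun_mul (hasDerivAt_id' t)).const_mul (c / 2))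
        exact this.congr_deriv (by ring)
      have hmono := (convex_Icc t₁ t₂).mul_sub_le_image_sub_of_le_deriv
        (f := fun t => -F t - c / 2 * (t * t)) (C := 0)
        (fun t _ => (hφ' t).continuousAt.continuousWithinAt)
        (fun t _ => (hφ' t).differentiableAt.differentiableWithinAt)
        (fun t ht => by
          rw [(hφ' t).deriv]
          have ht' := interior_subset ht
          have h1' := hin t ht'; have h2' := hneg t ht'
          rw [abs_of_neg h2'] at h1'; linarith) t₁ (left_mem_Icc.2 h12) t₂ (right_mem_Icc.2 h12) h12
      simp only [zero_mul] at hmono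
      rw [abs_sub_comm]
      calc c / 2 * (t₂ ^ 2 - t₁ ^ 2) ≤ F t₁ - F t₂ := by linarith
        _ ≤ |F t₁ - F t₂| := le_abs_self _
    · have hφ' : ∀ t, HasDerivAt (fun t => F t - c / 2 * (t * t)) (F' t - c * t) t := by
        intro t
        have := (hF t).fun_sub (((hasDerivAt_id' t).fun_mul (hasDerivAt_id' t)).const_mul (c / 2))
        exact this.congr_deriv (by ring)
      have hmono := (convex_Icc t₁ t₂).mul_sub_le_image_sub_of_le_deriv
        (f := fun t => F t - c / 2 * (t * t)) (C := 0)
        (fun t _ => (hφ' t).continuousAt.continuousWithinAt)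
        (fun t _ => (hφ' t).differentiableAt.differentiableWithinAt)
        (fun t ht => by
          rw [(hφ' t).deriv]
          have ht' := interior_subset ht
          have h1' := hin t ht'; have h2' := hpos t ht'
          rw [abs_of_pos h2'] at h1'; linarith) t₁ (left_mem_Icc.2 h12) t₂ (right_mem_Icc.2 h12) h12
      simp only [zero_mul] at hmono
      calc c / 2 * (t₂ ^ 2 - t₁ ^ 2) ≤ F t₂ - F t₁ := by linarith
        _ ≤ |F t₂ - F t₁| := le_abs_self _
  -- the affine part cancels against `t₁ + t₂`
  have h2δ : |F t₂ - F t₁| ≤ 2 * δ₀ + δ₁ * (t₁ + t₂) := by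
    calc |F t₂ - F t₁| ≤ |F t₂| + |F t₁| := abs_sub _ _
      _ ≤ 2 * δ₀ + δ₁ * (t₁ + t₂) := by linarith [h1.1, h2.1]
  set D := t₂ - t₁ with hDdef
  have hD0 : 0 ≤ D := sub_nonneg.2 h12
  have hS0 : 0 < t₁ + t₂ := by linarith
  -- `c·D·(t₁ + t₂) ≤ 4δ₀ + 2δ₁(t₁ + t₂)`
  have hstar : c * D * (t₁ + t₂) ≤ 4 * δ₀ + 2 * δ₁ * (t₁ + t₂) := by
    have e : t₂ ^ 2 - t₁ ^ 2 = D * (t₁ + t₂) := by rw [hDdef]; ring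
    rw [e] at hD; nlinarith
  -- hence `D ≤ 4δ₀/(c (t₁+t₂)) + 2δ₁/c`, and `(D − 2δ₁/c)·D ≤ 4δ₀/c`
  have hDc : c * (D - 2 * δ₁ / c) * (t₁ + t₂) ≤ 4 * δ₀ := by
    have e : c * (D - 2 * δ₁ / c) * (t₁ + t₂) = c * D * (t₁ + t₂) - 2 * δ₁ * (t₁ + t₂) := by
      rw [mul_sub, sub_mul, mul_div_cancel₀ _ hc.ne']
    rw [e]; linarith
  have hsqrt : D ≤ 2 * Real.sqrt (δ₀ / c) + 2 * δ₁ / c := by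
    by_cases hsmallD : D ≤ 2 * δ₁ / c
    · linarith [Real.sqrt_nonneg (δ₀ / c)]
    · have hpos : 0 < D - 2 * δ₁ / c := by linarith
      -- `(D − 2δ₁/c)² ≤ (D − 2δ₁/c)·D ≤ 4δ₀/c` (as `t₁ + t₂ ≥ D`)
      have hsq : (D - 2 * δ₁ / c) ^ 2 ≤ 4 * (δ₀ / c) := by
        have hDS : D ≤ t₁ + t₂ := by rw [hDdef]; linarith
        have h3 : c * (D - 2 * δ₁ / c) * D ≤ 4 * δ₀ := by
          have := mul_le_mul_of_nonneg_left hDS (by positivity : 0 ≤ c * (D - 2 * δ₁ / c))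
          linarith
        have h4 : (D - 2 * δ₁ / c) * D ≤ 4 * (δ₀ / c) := by
          rw [show 4 * (δ₀ / c) = 4 * δ₀ / c by ring, le_div_iff₀ hc]; linarith
        have h5 : (D - 2 * δ₁ / c) ^ 2 ≤ (D - 2 * δ₁ / c) * D := by
          have : 0 ≤ 2 * δ₁ / c := by positivity
          nlinarith
        linarith
      have : D - 2 * δ₁ / c ≤ 2 * Real.sqrt (δ₀ / c) := by
        calc D - 2 * δ₁ / c = Real.sqrt ((D - 2 * δ₁ / c) ^ 2) := by rw [Real.sqrt_sq hpos.le]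
          _ ≤ Real.sqrt (4 * (δ₀ / c)) := Real.sqrt_le_sqrt hsq
          _ = 2 * Real.sqrt (δ₀ / c) := by
              rw [show (4 : ℝ) * (δ₀ / c) = 2 ^ 2 * (δ₀ / c) by ring, Real.sqrt_mul (by norm_num), Real.sqrt_sq (by norm_num)]
      linarith
  split_ifs with hF0
  · exact hsqrt
  · push Not at hF0
    -- depth: `|F t₁ - F 0| ≤ M t₁²`, so `t₁ ≥ √(|F 0|/(2M))`
    have hdepth : |F t₁ - F 0| ≤ M * t₁ ^ 2 := by
      have hbd : ∀ s ∈ Icc 0 t₁, |F' s| ≤ M * t₁ := fun s hs =>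
        (hF'bd s).trans (by rw [abs_of_nonneg hs.1]; exact mul_le_mul_of_nonneg_left hs.2 hM.le)
      have := abs_sub_le_of_abs_deriv_le hF hbd (z := t₁) ⟨h0.le, le_rfl⟩
      calc |F t₁ - F 0| ≤ M * t₁ * (t₁ - 0) := this
        _ = M * t₁ ^ 2 := by ring
    have ht₁sq : |F 0| / (2 * M) ≤ t₁ ^ 2 := by
      rw [div_le_iff₀ (by positivity)]
      have := abs_sub_abs_le_abs_sub (F 0) (F t₁)
      rw [abs_sub_comm] at hdepth
      nlinarith [hF1]
    have hF0pos : 0 < |F 0| := by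
      have : 0 ≤ δ₀ + δ₁ * τ := by positivity
      linarith
    have ht₁ge : Real.sqrt |F 0| / Real.sqrt (2 * M) ≤ t₁ := by
      rw [← Real.sqrt_div (abs_nonneg _)]
      calc Real.sqrt (|F 0| / (2 * M)) ≤ Real.sqrt (t₁ ^ 2) := Real.sqrt_le_sqrt ht₁sq
        _ = t₁ := Real.sqrt_sq h0.le
    -- `D − 2δ₁/c ≤ 4δ₀/(c (t₁ + t₂)) ≤ 2δ₀/(c t₁)`
    have hlin : D - 2 * δ₁ / c ≤ 2 * δ₀ / (c * t₁) := by
      by_cases hsg : D - 2 * δ₁ / c ≤ 0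
      · exact hsg.trans (by positivity)
      · have hpos : 0 < D - 2 * δ₁ / c := lt_of_not_ge hsg
        rw [le_div_iff₀ (by positivity)]
        have h2t : c * (D - 2 * δ₁ / c) * (2 * t₁) ≤ c * (D - 2 * δ₁ / c) * (t₁ + t₂) :=
          mul_le_mul_of_nonneg_left (by linarith) (by positivity)
        have e : c * (D - 2 * δ₁ / c) * (2 * t₁) = 2 * ((D - 2 * δ₁ / c) * (c * t₁)) := by ring
        linarith
    have hsM : 0 < Real.sqrt (2 * M) := Real.sqrt_pos.2 (by positivity)
    have hsF : 0 < Real.sqrt |F 0| := Real.sqrt_pos.2 hF0pos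
    have : 2 * δ₀ / (c * t₁) ≤ 2 * δ₀ * Real.sqrt (2 * M) / (c * Real.sqrt |F 0|) := by
      calc 2 * δ₀ / (c * t₁) ≤ 2 * δ₀ / (c * (Real.sqrt |F 0| / Real.sqrt (2 * M))) := by
            apply div_le_div_of_nonneg_left (by positivity) (by positivity)
            exact mul_le_mul_of_nonneg_left ht₁ge hc.le
        _ = 2 * δ₀ * Real.sqrt (2 * M) / (c * Real.sqrt |F 0|) := by
            field_simp
    linarith

/-- **(L5 count, affine tolerance)** on the grid `t = (i+1)w`, `i < K₀`, `K₀w ≤ τ`: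
`#{i : |F tᵢ| ≤ δ₀ + δ₁tᵢ ∧ |G tᵢ| ≤ 2λ} ≤ (K₀w/min(η₀/(2Mτ), 2λ/M_G) + 1)·2(L/w + 1)` with the `L` of `pair_close_L5_affine`.
[cite: BenfattoGiulianiMastropietro2006, Lemma 3.1 / App. A2] -/
theorem gridCount_L5_affine {F F' G : ℝ → ℝ} (hF : ∀ t, HasDerivAt F (F' t) t)
    {M MG c lam η₀ τ δ₀ δ₁ : ℝ} (hM : 0 < M) (hMG : 0 < MG) (hc : 0 < c) (hlam : 0 < lam)
    (hτ : 0 < τ) (hη₀ : 0 < η₀) (hδ₀ : 0 ≤ δ₀) (hδ₁ : 0 ≤ δ₁) (hδη : δ₀ + δ₁ * τ ≤ η₀ / 2)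
    (hF'bd : ∀ t, |F' t| ≤ M * |t|) (hG : ∀ t t', |G t - G t'| ≤ MG * |t - t'|)
    (hkey : ∀ t, 0 < t → t ≤ τ → |F t| ≤ η₀ → |G t| ≤ 4 * lam → c * t ≤ |F' t|)
    {w : ℝ} (hw : 0 < w) {K₀ : ℕ} (hK : (K₀ : ℝ) * w ≤ τ) :
    ((((Finset.range K₀).filter fun i : ℕ =>
        |F (w + i * w)| ≤ δ₀ + δ₁ * (w + i * w) ∧ |G (w + i * w)| ≤ 2 * lam).card : ℝ)) ≤
      (K₀ * w / min (η₀ / (2 * M * τ)) (2 * lam / MG) + 1) *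
        (2 * ((if |F 0| ≤ 2 * (δ₀ + δ₁ * τ) then 2 * Real.sqrt (δ₀ / c) + 2 * δ₁ / c
          else 2 * δ₀ * Real.sqrt (2 * M) / (c * Real.sqrt |F 0|) + 2 * δ₁ / c) / w + 1)) := by
  classical
  have hL : 0 ≤ (if |F 0| ≤ 2 * (δ₀ + δ₁ * τ) then 2 * Real.sqrt (δ₀ / c) + 2 * δ₁ / c
      else 2 * δ₀ * Real.sqrt (2 * M) / (c * Real.sqrt |F 0|) + 2 * δ₁ / c) := by
    split_ifs <;> positivity
  refine gridCard_le_chop hw (lt_min (by positivity) (by positivity)) hL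
    (fun t => |F t| ≤ δ₀ + δ₁ * t ∧ |G t| ≤ 2 * lam) (fun _ => True)
    fun i j hi hj hij hPi hPj _ hclose => ?_
  have hij' : (i : ℝ) ≤ j := by exact_mod_cast hij
  have h0 : 0 < w + i * w := by positivity
  have h12 : w + i * w ≤ w + j * w := by nlinarith
  have h2τ : w + j * w ≤ τ := by
    have : (j : ℝ) + 1 ≤ K₀ := by exact_mod_cast Nat.succ_le_of_lt hj
    nlinarith
  have := pair_close_L5_affine hF hM hMG hc hlam hτ hδ₀ hδ₁ hδη hF'bd hG hkey h0 h12 h2τ hPi hPj (by linarith)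
  linarith

/-! ## §2 The instance on the band curve -/

section Band

variable {a b : ℝ} (B : BandBounds a b) {μ : ℝ} (hμ : μ ∈ Icc a b)
include B hμ

/-- **The count along one anti-diagonal at the affine tolerance** `δ₀ + δ₁t` (`t = (i+1)w ≤ τ`): the affine twin of `count_anti_sigma`
(lemma L5 with the key bound `even_key`); each cluster is wider by `2δ₁/(h_min/2) = 4δ₁/h_min` only.
[cite: BenfattoGiulianiMastropietro2006, Lemma 3.1 / App. A2] -/
theorem count_anti_sigma_affine {θ₁ w δ₀ δ₁ lam τ η₀ σ : ℝ} (hw : 0 < w) (hδ₀ : 0 ≤ δ₀) (hδ₁ : 0 ≤ δ₁) (hlam : 0 < lam)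
    (hτ : 0 < τ) (hη₀ : 0 < η₀) (hδη : δ₀ + δ₁ * τ ≤ η₀ / 2) (hlo : a ≤ μ - η₀) (hhi : μ + η₀ ≤ b)
    (hsmall : 2 * B.A2 * (η₀ / B.Dtmin + B.smax * (B.Cg * (lam + B.A2 * τ + 2 * B.smax * (η₀ / B.Dtmin)) + τ / 2)) ≤ B.hmin / 2) :
    ((((Finset.range ⌊τ / w⌋₊).filter fun i : ℕ =>
        |hfun μ θ₁ (σ - (w + i * w) / 2) (σ + (w + i * w) / 2)| ≤ δ₀ + δ₁ * (w + i * w) ∧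
          |Gfun μ θ₁ σ (w + i * w)| ≤ 2 * lam).card : ℝ)) ≤
      (⌊τ / w⌋₊ * w / min (η₀ / (2 * (2 * B.A2) * τ)) (2 * lam / (8 * B.smax ^ 2 + 4 * B.A2)) + 1) *
        (2 * ((if |hfun μ θ₁ σ σ| ≤ 2 * (δ₀ + δ₁ * τ) then 2 * Real.sqrt (δ₀ / (B.hmin / 2)) + 2 * δ₁ / (B.hmin / 2)
          else 2 * δ₀ * Real.sqrt (2 * (2 * B.A2)) / (B.hmin / 2 * Real.sqrt |hfun μ θ₁ σ σ|) + 2 * δ₁ / (B.hmin / 2)) / w + 1)) := by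
  obtain ⟨h1, h2⟩ := B.level hμ
  have hA := B.A2_pos; have hs := B.smax_pos; have hh := B.hmin_pos
  have h := gridCount_L5_affine (F := fun t => hfun μ θ₁ (σ - t / 2) (σ + t / 2))
    (F' := fun t => Real.sin (SX μ θ₁ (σ - t / 2) (σ + t / 2)) * (bandVX μ (σ + t / 2) - bandVX μ (σ - t / 2)) +
        Real.sin (SY μ θ₁ (σ - t / 2) (σ + t / 2)) * (bandVY μ (σ + t / 2) - bandVY μ (σ - t / 2)))
    (G := fun t => Gfun μ θ₁ σ t) (hasDerivAt_hfun_anti h1 h2 θ₁ σ)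
    (M := 2 * B.A2) (MG := 8 * B.smax ^ 2 + 4 * B.A2) (c := B.hmin / 2) (lam := lam) (η₀ := η₀) (τ := τ) (δ₀ := δ₀) (δ₁ := δ₁)
    (by positivity) (by positivity) (by positivity) hlam hτ hη₀ hδ₀ hδ₁ hδη
    (abs_anti_deriv_le B hμ θ₁ σ) (abs_Gfun_sub_le B hμ θ₁ σ)
    (fun t ht0 htτ hF hG => even_key B hμ ht0 htτ hlo hhi hF hG hsmall)
    hw (K₀ := ⌊τ / w⌋₊) (by
      have := Nat.floor_le (div_nonneg hτ.le hw.le) (a := τ / w)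
      rwa [le_div_iff₀ hw] at this)
  simp only [zero_div, sub_zero, add_zero] at h
  exact h

end Band

end Literature.MathematicalPhysics.QuantumLattice.BandSectorCounting

end
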